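import HarnessLib
import Summits.Ventures.WeilGRH.RealCharacterSmallModuli
import Summits.Ventures.WeilGRH.KCellsMod9OneA

/-!
# GRH arm (rh-explicit, venture WeilGRH): Weil positivity on `[−1, 1]` for EVERY non-principal EVEN Dirichlet character mod 9

Cell `rh-explicit`, WEIL TRACK — GRH ARM (seat weil-grh-1 gen12; pure assembly over weil-grh-2 gen15's checker-K χ-cell `KCellsMod9OneA`).
`(ℤ/9)ˣ = ⟨2⟩` is cyclic of order 6, so `χ(2) = ζ^i` with `ζ = exp(2πi/6)`, `i < 6`, and `χ(−1) = χ(2)^3 = (−1)^i`.  The even non-principal characters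
are the cubic pair `i = 2, 4` (conductor 9), both covered by the kernel-checked cell `KCellsMod9OneA` (`…_mod9_chi4_one` / `_conj`).  The odd characters
(`i = 1, 3, 5`: the sextic pair and `(−3/·)`) are NOT claimed at `t = 1`.  Pure assembly; RH/GRH-free; standard axioms.
-/

noncomputable section

namespace Summit.Ventures.WeilGRH.OneCompleteMod9Even
open Literature.NumberTheory.LFunctions
open scoped Real

/-- `exp(2πi/6)^3 = −1`. [folklore] -/
theorem zeta_pow_half_mod9 : (Complex.exp (2 * ↑Real.pi * Complex.I / 6)) ^ 3 = -1 := by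
  rw [← Complex.exp_nat_mul, show ((3 : ℕ) : ℂ) * (2 * ↑Real.pi * Complex.I / 6) = ↑Real.pi * Complex.I by push_cast; ring]
  exact Complex.exp_pi_mul_I

/-- ★ **Every non-principal EVEN Dirichlet character mod 9 satisfies Weil positivity on `[−1, 1]`.**
[cite: Weil1952FormulesExplicites, (11) pp. 261–262 and the «lemme» p. 262] -/
theorem weilPositivityOnChar_mod9_one_of_even (χ : DirichletCharacter ℂ 9) (hχ : χ ≠ 1) (he : χ.Even) :
    WeilPositivityOnChar χ 1 := by
  have hz : χ (2 : ZMod 9) ^ 6 = 1 := by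
    rw [← map_pow, show (2 : ZMod 9) ^ 6 = 1 from by decide, map_one]
  have hprim : IsPrimitiveRoot (Complex.exp (2 * ↑Real.pi * Complex.I / 6)) 6 := by
    exact_mod_cast Complex.isPrimitiveRoot_exp 6 (by norm_num)
  obtain ⟨i, hi, hiz⟩ := hprim.eq_pow_of_pow_eq_one hz
  have hm1 : χ (-1) = (Complex.exp (2 * ↑Real.pi * Complex.I / 6)) ^ (i * 3) := by
    rw [pow_mul, hiz, ← map_pow, show (2 : ZMod 9) ^ 3 = -1 from by decide]
  have he1 : χ (-1) = 1 := he
  interval_cases i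
  · exact absurd (RealCharacterSmallModuli.eq_one_of_apply_gen RealCharacterSmallModuli.units_mod_nine_gen (by rw [← hiz, pow_zero])) hχ
  · exfalso; rw [hm1, show 1 * 3 = 3 from rfl, zeta_pow_half_mod9] at he1; norm_num at he1
  · exact KCellsMod9OneA.weilPositivityOnChar_mod9_chi4_one χ hiz.symm
  · exfalso; rw [hm1, show 3 * 3 = 3 * 3 from rfl, pow_mul, zeta_pow_half_mod9] at he1; norm_num at he1
  · exact KCellsMod9OneA.weilPositivityOnChar_mod9_chi4_one_conj χ hiz.symm
  · exfalso; rw [hm1, show 5 * 3 = 3 * 5 from rfl, pow_mul, zeta_pow_half_mod9] at he1; norm_num at he1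

/-- Even non-principal characters mod 9 are Weil-positive on every window `[−t, t]`, `t ≤ 1`. [folklore] -/
theorem weilPositivityOnChar_of_le_one_mod9_of_even (χ : DirichletCharacter ℂ 9) (hχ : χ ≠ 1) (he : χ.Even) {t : ℝ} (ht : t ≤ 1) :
    WeilPositivityOnChar χ t := fun g hg hsupp ↦
  weilPositivityOnChar_mod9_one_of_even χ hχ he g hg (hsupp.trans (Set.Icc_subset_Icc (by linarith) ht))

end Summit.Ventures.WeilGRH.OneCompleteMod9Even

end
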